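import Summits.QuantumFields.BalabanUV.Beta.RelInvBorderedHessian
import Summits.QuantumFields.BalabanUV.Beta.RelInvCongruenceKernel

/-!
# `BalabanUV.Beta.RelInvCompositeSocket` — binder row D1, work item K-U3d leaf L4a: **THE `RelInv` END FOR THE COMPOSITE ONE-SHOT DRESSING (a1*)_m AS A
# SOCKET THEOREM** — `relInv_coDressKBmAt_KInv` (an2 g13) composed with `relInv_congr_kernel` (K-U3c) AT THE LITERAL'S TYPES: for ANY spread corrector pair
# `(Ψ, Φ)` with `Ψ∘Φ = idK = Φ∘Ψ` that preserves the `axEc` slice, `RelInv (Ψ∘coDressKBmAt ρ n (KInv n)∘Ψᵀ) (Φᵀ∘bhK n∘Φ) (axEc ρ n)`; L4 proper =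
# this with `Ψ := psiK r L m`, `Φ := phiK r L m` (L2) and the four identities of L3
# (β sub-cell, BINDER-OWNERS row D1 OWNER, lineage an2 gen 24; `gen24/K-U3d-LEAVES.v1.md` + ADDENDUM journal l.24201)

HONEST FRAMING (cell charter, verbatim): «discharging BetaPertH makes Balaban's UV stability UNCONDITIONAL — a real
constructive-QFT result; it is NOT the continuum limit and NOT the Clay problem.»
HONEST DEPENDENCY: continuum YM on T⁴ ⇐ BetaPertH ∧ nine spine estimates (0/9 proved); BetaPertH ⇐ (D1) ∧ (D4) ∧ CAP+tail;
G-an2-4 gates asym, D1 and NE2/3/4.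
ABSOLUTE RULE (cell, verbatim): «No internally-minted statement may enter as a cited fact. Every hypothesis is either kernel-proved in this
package or a verbatim quotation of a PUBLISHED theorem with page reference. The manuscript(s) under audit are NOT citable for their own
disputed steps — they are the thing under adjudication; programme-internal (2001/route/tribunal) claims are never citable.»
NOTHING below is cited: no `[cite: …]`, no `def`, no `Prop` fact.  [folklore] composition of tree theorems BY NAME: `RelInvBorderedHessian.relInv_coDressKBmAt_KInv`,
`spr_KInv`, `AxialDressingRooted.spr_coDressKBmAt`, `BorderedHessian.spr_bhK`, `AxialDressingRooted.spr_axEc ∕ trK_axEc`, `RelInvCongruenceKernel.relInv_congr_kernel`.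
The corrector pair `(Ψ, Φ)` and its three identities are PARAMETERS ∕ HYPOTHESES here (K-U3d L2∕L3 supply `psiK`∕`phiK` and prove them); NOTHING of (a1*) is
thereby «closed» (d1-formalise-ref I-d1ref30-2: the headline needs L3's identities BY NAME).

WHAT (all [folklore]): **`relInv_composite_of_corrector`** (the socket), `relInv_composite_of_corrector'` (the same with the re-linearised operator named by a hypothesis
`M* = Φᵀ∘bhK n∘Φ`, the shape `bhKcomp` will have by definition).
Provenance: β sub-cell, unit beta-an2 gen 24 (prover-b2b-balaban-beta-an2-g24-0), 2026-08-21.  NOT (SDF), NOT D1, NOT `BetaPertH`, NOT continuum, NOT Clay.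
-/

noncomputable section

open Literature.MathematicalPhysics.QuantumFieldTheory.Balaban1983to89
open Literature.MathematicalPhysics.QuantumFieldTheory.Balaban1983to89.Beta
open ExpKernelCalculus (MKer comp)
open AffineAveraging (box toSite)
open OneStepResolventKernel (Fib KInv)
open HessKerSchurResolvent (idK)
open Summit.QuantumFields.BalabanUV.Beta.TameKernelCalculus
open Summit.QuantumFields.BalabanUV.Beta.ChartConjugationRelative (RelInv)
open Summit.QuantumFields.BalabanUV.Beta.AxialDressingRooted (coDressKBmAt spr_coDressKBmAt axEc spr_axEc trK_axEc)
open Summit.QuantumFields.BalabanUV.Beta.BorderedHessian (bhK spr_bhK relInv_coDressKBmAt_KInv spr_KInv)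
open Summit.QuantumFields.BalabanUV.Beta.RelInvCongruenceKernel (relInv_congr_kernel)

namespace Summit.QuantumFields.BalabanUV.Beta.RelInvCompositeSocket

variable {d : ℕ} {N : ℕ} [NeZero N] {r : Fin (d + 1) → ℕ}

/-- [folklore] **THE COMPOSITE `RelInv` SOCKET.**  At blocking `N` (for the row: `N = Lc^m`) with in-block root `r`, for every SPREAD corrector pair `(Ψ, Φ)` on the packed
fibre with `Ψ∘Φ = idK = Φ∘Ψ` and `axEc`-slice preservation `(axEc∘Ψ)∘axEc = Ψ∘axEc`, `(axEc∘Φ)∘axEc = Φ∘axEc`: the Ψ-congruent co-dressed one-shot resolvent is a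
relative inverse of the Φ-congruent bordered Hessian w.r.t. the SAME coordinate projector —
`RelInv (Ψ∘coDressKBmAt ρ N (KInv N)∘Ψᵀ) (Φᵀ∘bhK N∘Φ) (axEc ρ N)`. -/
theorem relInv_composite_of_corrector (hr : r ∈ box (d + 1) N) {Ψ Φ : MKer (d + 1) (Fib d)} (hΨ : Spr Ψ) (hΦ : Spr Φ)
    (hΨΦ : comp Ψ Φ = idK) (hΦΨ : comp Φ Ψ = idK)
    (hEΨ : comp (comp (axEc (toSite r) N) Ψ) (axEc (toSite r) N) = comp Ψ (axEc (toSite r) N))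
    (hEΦ : comp (comp (axEc (toSite r) N) Φ) (axEc (toSite r) N) = comp Φ (axEc (toSite r) N)) :
    RelInv (comp (comp Ψ (coDressKBmAt (toSite r) N (KInv (N := N) (d := d)))) (trK Ψ)) (comp (comp (trK Φ) (bhK N)) Φ)
      (axEc (toSite r) N) := by
  have hN : 1 ≤ N := Nat.one_le_iff_ne_zero.mpr (NeZero.ne N)
  exact relInv_congr_kernel (spr_coDressKBmAt hN hr (spr_KInv (N := N) (d := d))) (spr_bhK hN) (spr_axEc _ _) hΨ hΦ
    (relInv_coDressKBmAt_KInv hr) hΨΦ hΦΨ (trK_axEc _ _) hEΨ hEΦ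

/-- [folklore] The same with the re-linearised operator NAMED (`M* = Φᵀ∘bhK N∘Φ` — the shape of the congruence-defined `bhKcomp` of leaf L4). -/
theorem relInv_composite_of_corrector' (hr : r ∈ box (d + 1) N) {Ψ Φ Mc : MKer (d + 1) (Fib d)} (hΨ : Spr Ψ) (hΦ : Spr Φ)
    (hΨΦ : comp Ψ Φ = idK) (hΦΨ : comp Φ Ψ = idK)
    (hEΨ : comp (comp (axEc (toSite r) N) Ψ) (axEc (toSite r) N) = comp Ψ (axEc (toSite r) N))
    (hEΦ : comp (comp (axEc (toSite r) N) Φ) (axEc (toSite r) N) = comp Φ (axEc (toSite r) N))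
    (hMc : Mc = comp (comp (trK Φ) (bhK N)) Φ) :
    RelInv (comp (comp Ψ (coDressKBmAt (toSite r) N (KInv (N := N) (d := d)))) (trK Ψ)) Mc (axEc (toSite r) N) := by
  rw [hMc]; exact relInv_composite_of_corrector hr hΨ hΦ hΨΦ hΦΨ hEΨ hEΦ

end Summit.QuantumFields.BalabanUV.Beta.RelInvCompositeSocket

end
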